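import Summits.QuantumFields.BalabanUV.Beta.FP.ConstrainedGhost
import Literature.MathematicalPhysics.QuantumFieldTheory.Balaban1983to89.Beta.DyadicShell

/-!
# Road FP (binder row D1), leaf H′2-IR ∕ IR-4 (part 1): THE n-UNIFORM NEAR-REGION LETTERS OF THE CONSTRAINED GHOST REMAINDER
# `ghostRem N = Gs − G₀` ON `ℤ⁴` FROM TWO PROFILE LETTERS — `|ghostRem N x x′| ≤ 162·A·K·N⁻²`, `|ghostRem N (x+e) x′ − ghostRem N x x′| ≤ 162·A′·K·N⁻³`

HONEST DEPENDENCY (page 1, mandatory): continuum YM on T⁴ ⇐ BetaPertH ∧ nine spine estimates (0/9 proved); BetaPertH ⇐ (D1) ∧ (D4) ∧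
CAP+tail; G-an2-4 gates asym, D1 and NE2/3/4.  HONEST FRAMING (cell contract, verbatim): «discharging `BetaPertH` makes Bałaban's UV
stability UNCONDITIONAL — a real constructive-QFT result; it is NOT the continuum limit and NOT the Clay problem.»  THIS MODULE is [folklore]
lattice power counting on `ℤ⁴` over the tree's sup-norm shells (`DyadicShell.supNorm`, `TransferUV.card_annulus_succ_four_le`) and ONE use of
this lineage's Woodbury identity `ConstrainedGhost.ghostRem_eq_tsum`; no `def`, no `def … : Prop`, nothing cited, 0 sorry.  Its two analytic
inputs are DISPLAYED HYPOTHESES (letters), NOT proved here: (S) the free-leg block-sum profile (proved in part 2 from lit1's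
`latticeGreen_asymptotics` [LawlerLimic2010 Thm 4.3.1, in tree] and the scale-`N` block power counting of row IR-1-ABS), and (W) the `N`-UNIFORM
profile of an2's multiplier column `Ws` — the row's ONE OPEN COARSE LETTER (the content of Gawędzki–Kupiainen 1980 Prop. A.2 ∕ [B9] Thm 3.2 for
the blocked massless scalar field: locality of `(Q′G₀Q′ᵀ)⁻¹`; an2's `ScalarBlockKKT.decay_wS` and g6's `ConstrainedGhost.exists_Ws_bound` are
FIXED-`N` statements and do NOT supply it).  It discharges NOTHING of H′2-IR ∕ `hasym` ∕ D1 until (W) is a theorem; 0∕4 binders of row D1;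
NOT D1, NOT BetaPertH, NOT continuum, NOT Clay.

ABSOLUTE RULE (cell charter, verbatim): «No internally-minted statement may enter as a cited fact. Every hypothesis is either kernel-proved
in this package or a verbatim quotation of a PUBLISHED theorem with page reference. The manuscript(s) under audit are NOT citable for their
own disputed steps — they are the thing under adjudication; programme-internal (2001/route/tribunal) claims are never citable.»

THE READING (owner's `N7-PROOF.v3.md` (H′2) ghost legs; `OWNER-RULINGS-FP-5.md` R-FP-18 (c) IR-4, E-FP-5-2 exact powers).  By `ghostRem_eq_tsum`
the Woodbury remainder of the block-constrained ghost leg is the coarse superposition `R(x,x′) = Σ'_y S(x,y)·Ws(y,x′)` with the free-leg block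
column `S(x,y) := blockSum N (G₀(x − ·)) y` (`G₀ = latticeGreen∕2`).  Writing `φ_s(w) := (‖w‖_∞ + 1)^{−s}` on `ℤ⁴`:
  (S)  `|S(x,y)| ≤ A·N²·φ₂(y − quo N x)`        — the scale-`N` block sum of a `‖z‖^{−2}` leg (power count `N⁴·(N(1+k))^{−2}`);
  (S′) `|S(x+e,y) − S(x,y)| ≤ A′·N·φ₃(y − quo N x)` — one power better for the gradient leg `‖z‖^{−3}`;
  (W)  `|Ws(y,x′)| ≤ K·N⁻⁴·φ_b(y − quo N x′)`, `b ≥ 3`, `K` free of `N` — the multiplier is `N^{−4} ×` an integrable coarse profile;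
then the two-centre shell bound `Σ_y φ_p(y−a)·φ_q(y−b) ≤ 2·Σ_y φ_{p+q}(y) ≤ 162` (`p + q ≥ 5`; nearer-centre split, `#sphere(r+1) ≤ 80(r+1)³`,
`Σ_{n≥2} n⁻² ≤ 1`) gives AT ONCE, for ALL `x, x′` (no near-region restriction is needed at these powers):
  `|ghostRem N x x′| ≤ 162·A·K·N⁻²`   and   `|ghostRem N (x+e) x′ − ghostRem N x x′| ≤ 162·A′·K·N⁻³`
— EXACTLY the powers `n^{2−d}`, `n^{1−d}` (`d = 4`) of E-FP-5-2 (toy `sup|R^Q|·n² = 0.074∕0.078`, journal l.20667).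

CONTENT. §1 sup-norm profile sums on `ℤ⁴` (box bound `≤ 81`, summability, `tsum ≤ 81`, translation, two-centre bound `≤ 162`); §2 the abstract
superposition bound `|Σ'_y S y·W y| ≤ 162·A·B`; §3 the ghost letters `abs_ghostRem_le_of_letters`, `abs_ghostRem_sub_le_of_letters` (+ source
versions by `ghostRem_symm`).
Unit `b2b-balaban-beta-d1-formalise-leaf-06` (gen 7), 2026-08-20; `LEAVES-FP.md` row H′2-IR ∕ IR-4; CLAIM «IR-4» (journal l.20936).
-/

namespace Summit.QuantumFields.BalabanUV.Beta.FP.ConstrainedGhostIR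

open Finset
open scoped BigOperators
open Literature.Probability.LatticeModels (box mem_box annulus mem_annulus latticeGreen)
open Literature.MathematicalPhysics.QuantumFieldTheory.Balaban1983to89.Beta
open DyadicShell (Pt supNorm supNorm_le_iff mem_box_iff mem_annulus_iff supNorm_eq_zero_iff supNorm_eq_of_mem_sphere natAbs_le_supNorm)
open TransferUV (card_annulus_succ_four_le sum_annulus_zero_eq_sum_shells)
open Literature.MathematicalPhysics.QuantumFieldTheory.LatticeForm (quo)
open AffineAveraging (blockSum)
open ScalarBlockKKT (Ws)
open ConstrainedGhost (ghostRem ghostRem_eq_tsum ghostRem_symm)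

noncomputable section

/-! ## §1 Sup-norm profile sums on `ℤ⁴` -/

/-- [folklore] The profile `φ_s(w) = ((‖w‖_∞ + 1)^s)⁻¹` is positive. -/
theorem profile_pos (s : ℕ) (w : Pt) : 0 < (((supNorm w : ℝ) + 1) ^ s)⁻¹ := by positivity

/-- [folklore] … and at most `1`. -/
theorem profile_le_one (s : ℕ) (w : Pt) : (((supNorm w : ℝ) + 1) ^ s)⁻¹ ≤ 1 := by
  apply inv_le_one_of_one_le₀
  exact one_le_pow₀ (by have := (Nat.cast_nonneg (supNorm w) : (0:ℝ) ≤ _); linarith)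

/-- [folklore] The profile is antitone in the exponent. -/
theorem profile_anti {s t : ℕ} (hst : s ≤ t) (w : Pt) : (((supNorm w : ℝ) + 1) ^ t)⁻¹ ≤ (((supNorm w : ℝ) + 1) ^ s)⁻¹ := by
  apply inv_anti₀ (by positivity)
  exact pow_le_pow_right₀ (by have := (Nat.cast_nonneg (supNorm w) : (0:ℝ) ≤ _); linarith) hst

/-- [folklore] … and antitone in the radius: `‖v‖_∞ ≤ ‖w‖_∞ ⟹ φ_s(w) ≤ φ_s(v)`. -/
theorem profile_anti_radius (s : ℕ) {v w : Pt} (h : supNorm v ≤ supNorm w) :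
    (((supNorm w : ℝ) + 1) ^ s)⁻¹ ≤ (((supNorm v : ℝ) + 1) ^ s)⁻¹ := by
  apply inv_anti₀ (by positivity)
  have h' : (supNorm v : ℝ) ≤ supNorm w := by exact_mod_cast h
  gcongr

/-- [folklore] The product of two profiles is the profile of the summed exponent. -/
theorem profile_mul (p q : ℕ) (w : Pt) :
    (((supNorm w : ℝ) + 1) ^ p)⁻¹ * (((supNorm w : ℝ) + 1) ^ q)⁻¹ = (((supNorm w : ℝ) + 1) ^ (p + q))⁻¹ := by
  rw [pow_add, mul_inv]

/-- [folklore] `Σ_{r<M} 1∕((r+1)(r+2)) = 1 − 1∕(M+1)` (telescoping). -/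
theorem sum_range_inv_mul_succ (M : ℕ) :
    ∑ r ∈ Finset.range M, ((((r : ℝ) + 1) * ((r : ℝ) + 2)))⁻¹ = 1 - (((M : ℝ) + 1))⁻¹ := by
  induction M with
  | zero => simp
  | succ M ih =>
    rw [Finset.sum_range_succ, ih]
    push_cast
    field_simp
    ring

/-- [folklore] `Σ_{r<M} (r+2)⁻² ≤ 1`. -/
theorem sum_range_inv_sq_le_one (M : ℕ) : ∑ r ∈ Finset.range M, (((r : ℝ) + 2) ^ 2)⁻¹ ≤ 1 := by
  calc ∑ r ∈ Finset.range M, (((r : ℝ) + 2) ^ 2)⁻¹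
      ≤ ∑ r ∈ Finset.range M, ((((r : ℝ) + 1) * ((r : ℝ) + 2)))⁻¹ := by
        refine Finset.sum_le_sum fun r _ => ?_
        apply inv_anti₀ (by positivity)
        nlinarith
    _ = 1 - (((M : ℝ) + 1))⁻¹ := sum_range_inv_mul_succ M
    _ ≤ 1 := by
        have : (0 : ℝ) ≤ (((M : ℝ) + 1))⁻¹ := by positivity
        linarith

/-- [folklore] SHELL BOUND: on the sup-sphere of radius `r+1`, `#sphere · φ_s ≤ 80(r+1)³∕(r+2)^s ≤ 80∕(r+2)²` once `s ≥ 5`. -/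
theorem card_sphere_mul_profile_le {s : ℕ} (hs : 5 ≤ s) (r : ℕ) :
    ((annulus 4 r (r + 1)).card : ℝ) * ((((r : ℝ) + 1) + 1) ^ s)⁻¹ ≤ 80 * (((r : ℝ) + 2) ^ 2)⁻¹ := by
  have hr : (0 : ℝ) ≤ r := Nat.cast_nonneg r
  have h1 : ((r : ℝ) + 1) + 1 = (r : ℝ) + 2 := by ring
  rw [h1]
  calc ((annulus 4 r (r + 1)).card : ℝ) * (((r : ℝ) + 2) ^ s)⁻¹
      ≤ 80 * ((r : ℝ) + 1) ^ 3 * (((r : ℝ) + 2) ^ s)⁻¹ :=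
        mul_le_mul_of_nonneg_right (card_annulus_succ_four_le r) (by positivity)
    _ ≤ 80 * ((r : ℝ) + 2) ^ (s - 2) * (((r : ℝ) + 2) ^ s)⁻¹ := by
        gcongr
        calc ((r : ℝ) + 1) ^ 3 ≤ ((r : ℝ) + 2) ^ 3 := by gcongr; linarith
          _ ≤ ((r : ℝ) + 2) ^ (s - 2) := pow_le_pow_right₀ (by linarith) (by omega)
    _ = 80 * (((r : ℝ) + 2) ^ 2)⁻¹ := by
        have h2 : ((r : ℝ) + 2) ≠ 0 := by positivity
        have hs' : s = (s - 2) + 2 := by omega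
        rw [hs', pow_add, mul_inv, show s - 2 + 2 - 2 = s - 2 by omega]
        field_simp

/-- [folklore] **BOX BOUND**: `Σ_{‖y‖_∞ ≤ M} φ_s(y) ≤ 81` for every `M`, once `s ≥ 5` (`1` at the origin `+ 80·Σ_{r<M}(r+2)⁻²`). -/
theorem sum_box_profile_le {s : ℕ} (hs : 5 ≤ s) (M : ℕ) :
    ∑ y ∈ box 4 M, (((supNorm y : ℝ) + 1) ^ s)⁻¹ ≤ 81 := by
  classical
  have hsplit : box 4 M = insert (0 : Pt) (annulus 4 0 M) := by
    ext y
    simp only [Finset.mem_insert, mem_annulus_iff, mem_box_iff]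
    constructor
    · intro h
      by_cases hy : y = 0
      · exact Or.inl hy
      · exact Or.inr ⟨Nat.pos_of_ne_zero fun h0 => hy (supNorm_eq_zero_iff.mp h0), h⟩
    · rintro (rfl | ⟨_, h⟩)
      · rw [supNorm_eq_zero_iff.mpr rfl]; exact Nat.zero_le _
      · exact h
  have h0 : (0 : Pt) ∉ annulus 4 0 M := by
    intro h
    have := (mem_annulus_iff.mp h).1
    rw [supNorm_eq_zero_iff.mpr rfl] at this
    exact Nat.lt_irrefl 0 this
  rw [hsplit, Finset.sum_insert h0, supNorm_eq_zero_iff.mpr rfl, sum_annulus_zero_eq_sum_shells]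
  have hshell : ∀ r ∈ Finset.range M, ∑ y ∈ annulus 4 r (r + 1), (((supNorm y : ℝ) + 1) ^ s)⁻¹ ≤ 80 * (((r : ℝ) + 2) ^ 2)⁻¹ := by
    intro r _
    calc ∑ y ∈ annulus 4 r (r + 1), (((supNorm y : ℝ) + 1) ^ s)⁻¹
        = ∑ _y ∈ annulus 4 r (r + 1), ((((r : ℝ) + 1) + 1) ^ s)⁻¹ := by
          refine Finset.sum_congr rfl fun y hy => ?_
          rw [supNorm_eq_of_mem_sphere hy]; push_cast; ring
      _ = ((annulus 4 r (r + 1)).card : ℝ) * ((((r : ℝ) + 1) + 1) ^ s)⁻¹ := by rw [Finset.sum_const, nsmul_eq_mul]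
      _ ≤ 80 * (((r : ℝ) + 2) ^ 2)⁻¹ := card_sphere_mul_profile_le hs r
  calc (((((0 : ℕ) : ℝ) + 1) ^ s)⁻¹ + ∑ r ∈ Finset.range M, ∑ y ∈ annulus 4 r (r + 1), (((supNorm y : ℝ) + 1) ^ s)⁻¹)
      ≤ 1 + ∑ r ∈ Finset.range M, 80 * (((r : ℝ) + 2) ^ 2)⁻¹ := by
        gcongr with r hr
        · simp
        · exact hshell r hr
    _ = 1 + 80 * ∑ r ∈ Finset.range M, (((r : ℝ) + 2) ^ 2)⁻¹ := by rw [Finset.mul_sum]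
    _ ≤ 1 + 80 * 1 := by gcongr; exact sum_range_inv_sq_le_one M
    _ = 81 := by norm_num

/-- [folklore] Every finite set of lattice points lies in some sup-box. -/
theorem exists_subset_box (u : Finset Pt) : ∃ M : ℕ, u ⊆ box 4 M := by
  classical
  refine ⟨u.sup supNorm, fun y hy => mem_box_iff.mpr (Finset.le_sup hy)⟩

/-- [folklore] Every finite partial sum of the profile is `≤ 81` (`s ≥ 5`). -/
theorem sum_profile_le {s : ℕ} (hs : 5 ≤ s) (u : Finset Pt) : ∑ y ∈ u, (((supNorm y : ℝ) + 1) ^ s)⁻¹ ≤ 81 := by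
  obtain ⟨M, hM⟩ := exists_subset_box u
  exact (Finset.sum_le_sum_of_subset_of_nonneg hM fun y _ _ => (profile_pos s y).le).trans (sum_box_profile_le hs M)

/-- [folklore] **SUMMABILITY** of `φ_s` on `ℤ⁴` for `s ≥ 5` (`s > d = 4`). -/
theorem summable_profile {s : ℕ} (hs : 5 ≤ s) : Summable fun y : Pt => (((supNorm y : ℝ) + 1) ^ s)⁻¹ :=
  summable_of_sum_le (fun y => (profile_pos s y).le) (sum_profile_le hs)

/-- [folklore] `Σ'_{y ∈ ℤ⁴} φ_s(y) ≤ 81` (`s ≥ 5`). -/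
theorem tsum_profile_le {s : ℕ} (hs : 5 ≤ s) : ∑' y : Pt, (((supNorm y : ℝ) + 1) ^ s)⁻¹ ≤ 81 :=
  Real.tsum_le_of_sum_le (fun y => (profile_pos s y).le) (sum_profile_le hs)

/-- [folklore] Translated profile: summable. -/
theorem summable_profile_sub {s : ℕ} (hs : 5 ≤ s) (a : Pt) : Summable fun y : Pt => (((supNorm (y - a) : ℝ) + 1) ^ s)⁻¹ :=
  (summable_profile hs).comp_injective (sub_left_injective (b := a))

/-- [folklore] Translated profile: `Σ'_y φ_s(y − a) ≤ 81`. -/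
theorem tsum_profile_sub_le {s : ℕ} (hs : 5 ≤ s) (a : Pt) : ∑' y : Pt, (((supNorm (y - a) : ℝ) + 1) ^ s)⁻¹ ≤ 81 := by
  have h := (Equiv.subRight a).tsum_eq (fun y : Pt => (((supNorm y : ℝ) + 1) ^ s)⁻¹)
  simp only [Equiv.subRight_apply] at h
  rw [h]
  exact tsum_profile_le hs

/-- [folklore] NEARER-CENTRE SPLIT: `φ_p(y−a)·φ_q(y−b) ≤ φ_{p+q}(y−a) + φ_{p+q}(y−b)`. -/
theorem profile_two_centre_le (p q : ℕ) (a b y : Pt) :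
    (((supNorm (y - a) : ℝ) + 1) ^ p)⁻¹ * (((supNorm (y - b) : ℝ) + 1) ^ q)⁻¹
      ≤ (((supNorm (y - a) : ℝ) + 1) ^ (p + q))⁻¹ + (((supNorm (y - b) : ℝ) + 1) ^ (p + q))⁻¹ := by
  rcases le_total (supNorm (y - a)) (supNorm (y - b)) with h | h
  · calc (((supNorm (y - a) : ℝ) + 1) ^ p)⁻¹ * (((supNorm (y - b) : ℝ) + 1) ^ q)⁻¹
        ≤ (((supNorm (y - a) : ℝ) + 1) ^ p)⁻¹ * (((supNorm (y - a) : ℝ) + 1) ^ q)⁻¹ :=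
          mul_le_mul_of_nonneg_left (profile_anti_radius q h) (profile_pos p _).le
      _ = (((supNorm (y - a) : ℝ) + 1) ^ (p + q))⁻¹ := profile_mul p q _
      _ ≤ _ := le_add_of_nonneg_right (profile_pos _ _).le
  · calc (((supNorm (y - a) : ℝ) + 1) ^ p)⁻¹ * (((supNorm (y - b) : ℝ) + 1) ^ q)⁻¹
        ≤ (((supNorm (y - b) : ℝ) + 1) ^ p)⁻¹ * (((supNorm (y - b) : ℝ) + 1) ^ q)⁻¹ :=
          mul_le_mul_of_nonneg_right (profile_anti_radius p h) (profile_pos q _).le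
      _ = (((supNorm (y - b) : ℝ) + 1) ^ (p + q))⁻¹ := profile_mul p q _
      _ ≤ _ := le_add_of_nonneg_left (profile_pos _ _).le

/-- [folklore] The two-centre product is summable (`p + q ≥ 5`). -/
theorem summable_profile_two_centre {p q : ℕ} (hpq : 5 ≤ p + q) (a b : Pt) :
    Summable fun y : Pt => (((supNorm (y - a) : ℝ) + 1) ^ p)⁻¹ * (((supNorm (y - b) : ℝ) + 1) ^ q)⁻¹ :=
  Summable.of_nonneg_of_le (fun _ => (mul_pos (profile_pos _ _) (profile_pos _ _)).le) (profile_two_centre_le p q a b)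
    ((summable_profile_sub hpq a).add (summable_profile_sub hpq b))

/-- [folklore] **TWO-CENTRE BOUND**: `Σ'_y φ_p(y−a)·φ_q(y−b) ≤ 162`, for ALL centres `a, b` (`p + q ≥ 5`). -/
theorem tsum_profile_two_centre_le {p q : ℕ} (hpq : 5 ≤ p + q) (a b : Pt) :
    ∑' y : Pt, (((supNorm (y - a) : ℝ) + 1) ^ p)⁻¹ * (((supNorm (y - b) : ℝ) + 1) ^ q)⁻¹ ≤ 162 := by
  calc ∑' y : Pt, (((supNorm (y - a) : ℝ) + 1) ^ p)⁻¹ * (((supNorm (y - b) : ℝ) + 1) ^ q)⁻¹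
      ≤ ∑' y : Pt, ((((supNorm (y - a) : ℝ) + 1) ^ (p + q))⁻¹ + (((supNorm (y - b) : ℝ) + 1) ^ (p + q))⁻¹) :=
        (summable_profile_two_centre hpq a b).tsum_le_tsum (profile_two_centre_le p q a b)
          ((summable_profile_sub hpq a).add (summable_profile_sub hpq b))
    _ = ∑' y : Pt, (((supNorm (y - a) : ℝ) + 1) ^ (p + q))⁻¹ + ∑' y : Pt, (((supNorm (y - b) : ℝ) + 1) ^ (p + q))⁻¹ :=
        (summable_profile_sub hpq a).tsum_add (summable_profile_sub hpq b)
    _ ≤ 81 + 81 := add_le_add (tsum_profile_sub_le hpq a) (tsum_profile_sub_le hpq b)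
    _ = 162 := by norm_num

/-! ## §2 The abstract superposition bound -/

/-- [folklore] **SUPERPOSITION OF TWO PROFILE LETTERS**: `|S y| ≤ A·φ_p(y−a)`, `|W y| ≤ B·φ_q(y−b)`, `p + q ≥ 5` ⟹ `Σ'_y S y·W y` converges
absolutely and `|Σ'_y S y·W y| ≤ 162·A·B`. -/
theorem abs_tsum_mul_le_of_profiles {S W : Pt → ℝ} {A B : ℝ} {p q : ℕ} (hpq : 5 ≤ p + q) (a b : Pt)
    (hS : ∀ y, |S y| ≤ A * (((supNorm (y - a) : ℝ) + 1) ^ p)⁻¹) (hW : ∀ y, |W y| ≤ B * (((supNorm (y - b) : ℝ) + 1) ^ q)⁻¹) :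
    Summable (fun y => S y * W y) ∧ |∑' y, S y * W y| ≤ 162 * A * B := by
  have hA : 0 ≤ A := (mul_nonneg_iff_of_pos_right (profile_pos p _)).mp ((abs_nonneg _).trans (hS a))
  have hB : 0 ≤ B := (mul_nonneg_iff_of_pos_right (profile_pos q _)).mp ((abs_nonneg _).trans (hW b))
  have hdom : ∀ y, ‖S y * W y‖ ≤ (A * B) * ((((supNorm (y - a) : ℝ) + 1) ^ p)⁻¹ * (((supNorm (y - b) : ℝ) + 1) ^ q)⁻¹) := by
    intro y
    rw [Real.norm_eq_abs, abs_mul]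
    calc |S y| * |W y| ≤ (A * (((supNorm (y - a) : ℝ) + 1) ^ p)⁻¹) * (B * (((supNorm (y - b) : ℝ) + 1) ^ q)⁻¹) :=
          mul_le_mul (hS y) (hW y) (abs_nonneg _) (mul_nonneg hA (profile_pos p _).le)
      _ = (A * B) * ((((supNorm (y - a) : ℝ) + 1) ^ p)⁻¹ * (((supNorm (y - b) : ℝ) + 1) ^ q)⁻¹) := by ring
  have hg : Summable fun y => (A * B) * ((((supNorm (y - a) : ℝ) + 1) ^ p)⁻¹ * (((supNorm (y - b) : ℝ) + 1) ^ q)⁻¹) :=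
    (summable_profile_two_centre hpq a b).mul_left (A * B)
  have hsum : Summable (fun y => S y * W y) := Summable.of_norm_bounded hg hdom
  refine ⟨hsum, ?_⟩
  calc |∑' y, S y * W y| = ‖∑' y, S y * W y‖ := (Real.norm_eq_abs _).symm
    _ ≤ ∑' y, (A * B) * ((((supNorm (y - a) : ℝ) + 1) ^ p)⁻¹ * (((supNorm (y - b) : ℝ) + 1) ^ q)⁻¹) :=
        tsum_of_norm_bounded hg.hasSum hdom
    _ = (A * B) * ∑' y, (((supNorm (y - a) : ℝ) + 1) ^ p)⁻¹ * (((supNorm (y - b) : ℝ) + 1) ^ q)⁻¹ := tsum_mul_left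
    _ ≤ (A * B) * 162 := mul_le_mul_of_nonneg_left (tsum_profile_two_centre_le hpq a b) (mul_nonneg hA hB)
    _ = 162 * A * B := by ring

/-! ## §3 The ghost letters -/

section Ghost

variable {N : ℕ} [NeZero N]

/-- **THE GHOST REMAINDER IS `O(N⁻²)` UNIFORMLY** ⟸ (S) ∧ (W).  [folklore] assembly: `ghostRem_eq_tsum` + `abs_tsum_mul_le_of_profiles` with
`p = 2`, `q = b ≥ 3`.  The free-leg block-sum letter (S) and the `N`-uniform multiplier letter (W) are DISPLAYED HYPOTHESES (header). -/
theorem abs_ghostRem_le_of_letters {A K : ℝ} {b : ℕ} (hb : 3 ≤ b)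
    (hS : ∀ x y : Pt, |blockSum N (fun z => latticeGreen (x - z) / 2) y| ≤ A * (N : ℝ) ^ 2 * (((supNorm (y - quo N x) : ℝ) + 1) ^ 2)⁻¹)
    (hW : ∀ y x' : Pt, |Ws (d := 3) (N := N) y x'| ≤ K * ((N : ℝ) ^ 4)⁻¹ * (((supNorm (y - quo N x') : ℝ) + 1) ^ b)⁻¹)
    (x x' : Pt) : |ghostRem (d := 3) N x x'| ≤ 162 * A * K * ((N : ℝ) ^ 2)⁻¹ := by
  rw [ghostRem_eq_tsum (by norm_num) x x']
  have h := (abs_tsum_mul_le_of_profiles (S := fun y => blockSum N (fun z => latticeGreen (x - z) / 2) y)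
    (W := fun y => Ws (d := 3) (N := N) y x') (p := 2) (q := b) (by omega) (quo N x) (quo N x') (fun y => hS x y) (fun y => hW y x')).2
  have hN : (N : ℝ) ≠ 0 := Nat.cast_ne_zero.mpr (NeZero.ne N)
  calc |∑' y, blockSum N (fun z => latticeGreen (x - z) / 2) y * Ws (d := 3) (N := N) y x'|
      ≤ 162 * (A * (N : ℝ) ^ 2) * (K * ((N : ℝ) ^ 4)⁻¹) := h
    _ = 162 * A * K * ((N : ℝ) ^ 2)⁻¹ := by field_simp

/-- The same bound in the SOURCE variable (the remainder is symmetric, `ghostRem_symm`). [folklore] -/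
theorem abs_ghostRem_le_of_letters' {A K : ℝ} {b : ℕ} (hb : 3 ≤ b)
    (hS : ∀ x y : Pt, |blockSum N (fun z => latticeGreen (x - z) / 2) y| ≤ A * (N : ℝ) ^ 2 * (((supNorm (y - quo N x) : ℝ) + 1) ^ 2)⁻¹)
    (hW : ∀ y x' : Pt, |Ws (d := 3) (N := N) y x'| ≤ K * ((N : ℝ) ^ 4)⁻¹ * (((supNorm (y - quo N x') : ℝ) + 1) ^ b)⁻¹)
    (x x' : Pt) : |ghostRem (d := 3) N x' x| ≤ 162 * A * K * ((N : ℝ) ^ 2)⁻¹ := by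
  rw [ghostRem_symm]; exact abs_ghostRem_le_of_letters hb hS hW x x'

/-- **THE GRADIENT OF THE GHOST REMAINDER IS `O(N⁻³)` UNIFORMLY** ⟸ (S′) ∧ (W): for ANY lattice shift `e` (a unit vector on the road),
`|ghostRem N (x+e) x′ − ghostRem N x x′| ≤ 162·A′·K·N⁻³`.  [folklore] assembly: the two Woodbury series are subtracted termwise and
`abs_tsum_mul_le_of_profiles` is applied with `p = 3`, `q = b ≥ 3`. -/
theorem abs_ghostRem_sub_le_of_letters {A' K : ℝ} {b : ℕ} (hb : 3 ≤ b) (e : Pt)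
    (hS' : ∀ x y : Pt, |blockSum N (fun z => latticeGreen (x + e - z) / 2) y - blockSum N (fun z => latticeGreen (x - z) / 2) y|
      ≤ A' * (N : ℝ) * (((supNorm (y - quo N x) : ℝ) + 1) ^ 3)⁻¹)
    (hW : ∀ y x' : Pt, |Ws (d := 3) (N := N) y x'| ≤ K * ((N : ℝ) ^ 4)⁻¹ * (((supNorm (y - quo N x') : ℝ) + 1) ^ b)⁻¹)
    (x x' : Pt) : |ghostRem (d := 3) N (x + e) x' - ghostRem (d := 3) N x x'| ≤ 162 * A' * K * ((N : ℝ) ^ 3)⁻¹ := by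
  -- summability of both Woodbury series from the fixed-`N` bounds of `ConstrainedGhost`
  have hs : ∀ p : Pt, Summable fun y => blockSum N (fun z => latticeGreen (p - z) / 2) y * Ws (d := 3) (N := N) y x' :=
    fun p => ConstrainedGhost.summable_bdd_mul_Ws (fun y => ConstrainedGhost.abs_blockSum_free_le (by norm_num) p y) x'
  rw [ghostRem_eq_tsum (by norm_num) (x + e) x', ghostRem_eq_tsum (by norm_num) x x', ← (hs (x + e)).tsum_sub (hs x)]
  simp only [← sub_mul]
  have h := (abs_tsum_mul_le_of_profiles
    (S := fun y => blockSum N (fun z => latticeGreen (x + e - z) / 2) y - blockSum N (fun z => latticeGreen (x - z) / 2) y)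
    (W := fun y => Ws (d := 3) (N := N) y x') (p := 3) (q := b) (by omega) (quo N x) (quo N x') (fun y => hS' x y) (fun y => hW y x')).2
  have hN : (N : ℝ) ≠ 0 := Nat.cast_ne_zero.mpr (NeZero.ne N)
  calc |∑' y, (blockSum N (fun z => latticeGreen (x + e - z) / 2) y - blockSum N (fun z => latticeGreen (x - z) / 2) y) * Ws (d := 3) (N := N) y x'|
      ≤ 162 * (A' * (N : ℝ)) * (K * ((N : ℝ) ^ 4)⁻¹) := h
    _ = 162 * A' * K * ((N : ℝ) ^ 3)⁻¹ := by field_simp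

end Ghost

end

end Summit.QuantumFields.BalabanUV.Beta.FP.ConstrainedGhostIR
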